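import Summits.QuantumFields.YangMills.Theorems.BalabanUVNodesK0AxComplexGaussianRatio

/-!
# K0ᴬ∕K0⁷ — CGRS file №2: SYMMETRISATION (dock without any symmetry hypothesis) and THE GAUSSIAN TAIL BRICK for the cut-off face (F-tail)
(◇ lens-1 g13 NODE v14∕v15 «N4-R ⟸ CGRS brick + model faces»; generic, model-free, Mathlib-only; consumer = FE-2 of ⟨27930⟩ via N4-R of v13.2∕v13.3)

LANDING NOTE (porter ▶ PTC-1 g4, 2026-08-31; AUTHORSHIP = ◇ lens-1 g13 «cauchy-analytic», HOME file `nodeO-cover/LENS-1g13-ComplexGaussianRatioTail-v1.lean` sha16 d7a211ed1d8ec2fe · 318 l. · 21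
thm + 2 def (`gaussSymmPart`, `gaussInvCol`) (CANDIDATE 3 of g13 = CGRS FILE №2: §9 SYMMETRISATION — DEF-1's carriers `gaussIntC`∕`gaussNormC`∕`gaussRatioC` are invariant under `M ↦ ½(M + Mᵀ)`
with NO hypothesis, so (F-sym) is never a kill and CGRS (iii) holds under the single regime hypothesis `((gaussSymmPart M).map re).PosDef`; §10 the GAUSSIAN TAIL brick for the cut-off face
(F-tail): marginal tail in the congruence frame, `gaussR_tail_le`, `gaussR_cutoff_tail_le`, and the assembled `norm_gaussRatioC_sub_one_le_box`); farm evidence = ◇'s monolith v2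
`nodeO-cover/evidence/LENS-1g13-CGR-monolith-check-v2.lean` 1190981218b4281f rc 0 · 0 warn · 0 sorry, axioms standard): landed under ◇'s basename
`…Theorems/BalabanUVNodesK0AxComplexGaussianRatioTail.lean` (ns `…Theorems.K0AxComplexGaussianRatio`), one import ✓p826928 `…K0AxComplexGaussianRatio` (split PART C), as INTENT-82; `--supports
stmt-QuantumFields-27930 --as helper --cite Balaban1987RG1 --cite Brydges1986` (NO `--workitem`; kind auto ⇒ definition because of the 2 defs). BYTES: VERBATIM except ONE declared mechanical
erratum — the HOME file's bib key `Brydges1986Course` does not exist in `lean/references.bib` (the gate's lint bounces a `[cite:]` whose LEADING key is unknown; 8 docstrings here lead with it);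
the tree's key for the SAME source (D. C. Brydges, «A short course on cluster expansions», Les Houches 1984 Session XLIII, North-Holland 1986, pp. 129–183) is `Brydges1986`, substituted at all 14
occurrences (as in split PARTS B∕C); plus this paragraph. ◆ CRIT-1's cut: ◆ CRIT-1 g39 «(1) CUT — ◇ CANDIDATE 3 = CGRS file №2 d7a211ed1d8ec2fe · 318 l. · 21 thm + 2 def · 0 `: Prop
:=`∕instance∕notation∕structure∕sorry → GO on these bytes ⊕ the MANDATORY BIBFIX `Brydges1986Course` → `Brydges1986` (14 occurrences: header l.7 + 13 `[cite:]`, 8 LEADING — the lint class that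
bounced part B's dry-run №1), NO other byte change, same ns, `--supports stmt-QuantumFields-27930 --as helper --cite Balaban1988RG2Cluster --cite Brydges1986`; EVIDENCE: standalone probe
`scratch/CGRTail_probe.lean` (№2 verbatim on its TREE import ✓p826928 + 21 `#guard_msgs … #print axioms` std guards) farm rc 0 · 0 err · 0 warn · 0 sorry, planted negative control rc 1 as expected
⇒ guards live; J4: 23 names × {Summits, Literature, HarnessLib} = 0; stmt-dedup: `½(M+Mᵀ)` 0 def twins · `A⁻¹ *ᵥ Pi.single` 0 · indicator-tail 0 · the completing-the-square +
`integral_sub_right_eq_self` DEVICE has ONE in-tree precedent in another currency: `Literature/Barriers/CriticalPhenomena/RigorousRGSmallParameterSusceptibilityFormula.lean` :536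
`covInvForm_sub_smul_unitField` + :590 `gaussConvZ0_smul_unitField` (Slade Lemma 8.2.1, φ⁴ torus covariance, fixed direction `unitField`) — same move, not a statement twin of
`integral_exp_mul_gaussR` over a general `A ≻ 0` ⇒ rider R-l: cited HERE as precedent, no reuse possible; J1′: theorems + 2 plain-data defs, `gaussInvCol`'s `Matrix.inv` junk at singular `A` used
ONLY under `A.PosDef`, every regime hypothesis displayed, the two residual hypotheses of `norm_gaussRatioC_sub_one_le_box` (`hnum`, `htail_int`) are integrability bookkeeping honestly labelled;
mathematics re-derived on paper (:154 completing the square, :176 ∫e^{t xᵢ}e^{−½q} = e^{t²(A⁻¹)ᵢᵢ∕2}·gaussNormR A, :197 Chernoff at t = r∕v ⇒ 2e^{−r²∕(2v)}, :246 union bound, §9 invariance under M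
↦ ½(M+Mᵀ) with NO hypothesis) ✓; SAME-WALL: S, generic Mathlib-level; located-A = two displayed hypotheses of N4-R's |c| = 1 clause REMOVED ((F-sym) for free, (F-tail) generic half proved with an
explicit T); located-B UNCHANGED = model faces (F-coer)∕(F-im)∕(F-int), (H-num)∕(H-den) holomorphy, N8b — not a tautology, SURVIVES priced; customs at landing: declcmp 23∕23 + std axioms ×21 from
the tree module» (nodeO STATUS 2026-08-31T15:30:54Z). HONEST (porter): Mathlib theorems about quadratic forms and parametric Gaussian integrals over `ι → ℝ`; nothing of Bałaban asserted, ported,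
discharged or refuted; N4-R's MODEL faces (F-coer)∕(F-int)∕(F-im)'s model inequality and the holomorphy half are NOT here; `stub_FE`∕`stub_P0C` and the crux ⟨27930⟩ OPEN; K0⁷ 20541 ∕ K0ᴬ 27238 ∕
K1ᴬ ∕ K3ᴬ OPEN — NOTHING of them proved; NODE O 0∕1; COUNT 8∕28 · K 1∕4 UNMOVED; finite 𝕋⁴ at fixed ε — NOT continuum ∕ OS ∕ Clay; the Yang–Mills mass gap is NOT proved by any of this.

[I] = [Balaban1987RG1], [II] = [Balaban1988RG2Cluster], [Br] = [Brydges1986].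

WHAT.  Continues `…Theorems.BalabanUVNodesK0AxComplexGaussianRatio` (CGRS: `‖gaussRatioC χ M E‖ ≤ exp(η + ¼tr(A⁻¹BA⁻¹B))` under `Re M ≻ 0`, `Im M` symmetric; `‖R − 1‖ ≤ e^{¼tr}(η₁ + T)` given a
TAIL budget `T`).  Two of the displayed hypotheses are DISCHARGED here, generically:
* §9 SYMMETRISATION (★★ DEF-1 g39's answer, STATUS l.5709: `piecesFormC` is NOT symmetric by `simp` — dock through the symmetric part, which is free): `quadC Mᵀ x = quadC M x`, hence
  `quadC (gaussSymmPart M) = quadC M` with `gaussSymmPart M := ½(M + Mᵀ)` and DEF-1's three carriers are INVARIANT: `gaussIntC_gaussSymmPart`, `gaussNormC_gaussSymmPart`, `gaussRatioC_gaussSymmPart` (no hypothesis);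
  ★★★ `norm_gaussRatioC_le_exp_trace_gaussSymmPart` — CGRS (iii) with the ONLY regime hypothesis `(Re gaussSymmPart M).PosDef` (the symmetry hypothesis `hB` disappears: `isSymm_gaussSymmPart_map_im`); `gaussNormC_ne_zero_gaussSymmPart`.
* §10 THE GAUSSIAN TAIL (the face (F-tail) of NODE v14, now a theorem): `integrable_gaussR_of_posDef`, `gaussNormR_pos` (A ≻ 0); ★ `quadFormR_sub_gaussInvCol` — completing the square along one coordinate,
  `q(x − t·A⁻¹e_i) = q(x) − 2t·x_i + t²(A⁻¹)_ii`; ★ `integral_exp_mul_gaussR` — the exponential moment `∫e^{t x_i}e^{−½q} = e^{t²(A⁻¹)_ii∕2}·gaussNormR A` (translation invariance of Lebesgue measure);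
  ★★ `gaussR_tail_le` — Chernoff: `∫𝟙{r < |x_i|}e^{−½q} ≤ 2e^{−r²∕(2(A⁻¹)_ii)}·gaussNormR A`; ★★ `gaussR_cutoff_tail_le` — for `0 ≤ χ ≤ 1` equal to `1` on the box `{∀ i, |x_i| ≤ r}`:
  `∫(1−χ)e^{−½q} ≤ (2Σ_i e^{−r²∕(2(A⁻¹)_ii)})·gaussNormR A` (= hypothesis `htail` of `norm_gaussRatioC_sub_one_le` with an explicit `T`); `integrable_gaussNormC_integrand` (discharges `hden_int`);
  ★★★ `norm_gaussRatioC_sub_one_le_box` — the `|c| = 1` clause of N4-R in closed form: `‖gaussRatioC χ M E − 1‖ ≤ e^{¼tr(A⁻¹BA⁻¹B)}·(η₁ + 2Σ_i e^{−r²∕(2(A⁻¹)_ii)})`.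
CONSUMER: with `χ := chiRem …` (an indicator of a box of radius `r = p(ε₁)`-type in the record's currency, ✓`chiRem_nonneg_le_one`) the remaining displayed hypotheses of the `|c| = 1` clause are
measurability bookkeeping (`hnum`, `htail_int`) and the three MODEL faces (F-coer) `Re ½(M+Mᵀ) ≻ 0`, (F-im) the trace budget, (F-int) `‖e^{E} − 1‖ ≤ η₁` on the box — hands' currency, NOT asserted here.

HONEST FRAMING.  Mathlib-only theorems about finite-dimensional Gaussian integrals over `ι → ℝ`; junk discipline ◆ (R-a) respected (no `def … : Prop`; `gaussInvCol`∕`gaussSymmPart` are plain data; every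
regime hypothesis displayed or proved).  Nothing of Bałaban is asserted, ported or discharged; the model faces and the holomorphy half of N4-R are NOT here; `stub_FE`∕`stub_P0C` OPEN, ⟨27930⟩ OPEN;
K0⁷∕K0ᴬ∕K1ᴬ∕K3ᴬ OPEN; NODE O 0∕1; finite `𝕋⁴_{L^K}` at fixed ε — NOT continuum∕OS; **the Yang–Mills mass gap (Clay) is NOT proved by any of this.**  No `sorry`, `instance`, `notation`,
`structure`, `private`; standard axioms.
-/

noncomputable section

open scoped BigOperators
open MeasureTheory Complex

namespace Summit.QuantumFields.YangMills.Theorems.K0AxComplexGaussianRatio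

open Summit.QuantumFields.YangMills.Theorems.K0RecordFormatNames (quadC gaussIntC gaussNormC gaussRatioC)

variable {ι : Type*} [Fintype ι]

/-! ## §9  SYMMETRISATION — the quadratic form only sees `½(M + Mᵀ)` (so (F-sym) is never a kill: dock through the symmetric part) -/

section Symmetrise

open Matrix

/-- `quadC Mᵀ x = quadC M x`. [cite: Balaban1987RG1, (2.12) p.268 (bookkeeping)] -/
theorem quadC_transpose (M : Matrix ι ι ℂ) (x : ι → ℝ) : quadC Mᵀ x = quadC M x := by
  unfold quadC
  rw [Finset.sum_comm]
  refine Finset.sum_congr rfl fun a _ => Finset.sum_congr rfl fun b _ => ?_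
  rw [Matrix.transpose_apply]
  ring

/-- `quadC (M + N) x = quadC M x + quadC N x`. [cite: Balaban1987RG1, (2.12) p.268 (bookkeeping)] -/
theorem quadC_add (M N : Matrix ι ι ℂ) (x : ι → ℝ) : quadC (M + N) x = quadC M x + quadC N x := by
  simp only [quadC, Matrix.add_apply, mul_add, add_mul, Finset.sum_add_distrib]

/-- `quadC (a • M) x = a * quadC M x`. [cite: Balaban1987RG1, (2.12) p.268 (bookkeeping)] -/
theorem quadC_const_smul (a : ℂ) (M : Matrix ι ι ℂ) (x : ι → ℝ) : quadC (a • M) x = a * quadC M x := by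
  simp only [quadC, Matrix.smul_apply, smul_eq_mul, Finset.mul_sum]
  refine Finset.sum_congr rfl fun i _ => Finset.sum_congr rfl fun j _ => ?_
  ring

/-- The symmetric part: `gaussSymmPart M := ½(M + Mᵀ)`. [cite: Balaban1987RG1, (2.12) p.268 (bookkeeping)] -/
def gaussSymmPart (M : Matrix ι ι ℂ) : Matrix ι ι ℂ := (1 / 2 : ℂ) • (M + Mᵀ)

omit [Fintype ι] in
/-- `gaussSymmPart M` is symmetric. [cite: Balaban1987RG1, (2.12) p.268 (bookkeeping)] -/
theorem isSymm_gaussSymmPart (M : Matrix ι ι ℂ) : (gaussSymmPart M).IsSymm := by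
  unfold gaussSymmPart
  rw [Matrix.IsSymm, Matrix.transpose_smul, Matrix.transpose_add, Matrix.transpose_transpose, add_comm]

omit [Fintype ι] in
/-- The imaginary part of `gaussSymmPart M` is symmetric (the hypothesis `hB` of `gaussNormC_floor` holds automatically after symmetrisation). [cite: Balaban1987RG1, (2.12) p.268 (bookkeeping)] -/
theorem isSymm_gaussSymmPart_map_im (M : Matrix ι ι ℂ) : ((gaussSymmPart M).map Complex.im).IsSymm :=
  (isSymm_gaussSymmPart M).map _

/-- ★ `quadC (gaussSymmPart M) x = quadC M x`. [cite: Balaban1987RG1, (2.12) p.268 (bookkeeping)] -/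
theorem quadC_gaussSymmPart (M : Matrix ι ι ℂ) (x : ι → ℝ) : quadC (gaussSymmPart M) x = quadC M x := by
  unfold gaussSymmPart
  rw [quadC_const_smul, quadC_add, quadC_transpose]
  ring

/-- ★ DEF-1's carriers only see the symmetric part: `gaussIntC χ (gaussSymmPart M) E = gaussIntC χ M E`. [cite: Balaban1987RG1, (2.12)–(2.13) p.268 (bookkeeping)] -/
theorem gaussIntC_gaussSymmPart (χ : (ι → ℝ) → ℝ) (M : Matrix ι ι ℂ) (E : (ι → ℝ) → ℂ) : gaussIntC χ (gaussSymmPart M) E = gaussIntC χ M E := by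
  unfold gaussIntC
  simp_rw [quadC_gaussSymmPart]

/-- `gaussNormC (gaussSymmPart M) = gaussNormC M`. [cite: Balaban1987RG1, (2.12) p.268 (bookkeeping)] -/
theorem gaussNormC_gaussSymmPart (M : Matrix ι ι ℂ) : gaussNormC (gaussSymmPart M) = gaussNormC M := by
  unfold gaussNormC
  simp_rw [quadC_gaussSymmPart]

/-- `gaussRatioC χ (gaussSymmPart M) E = gaussRatioC χ M E`. [cite: Balaban1987RG1, (2.12)–(2.13) p.268 (bookkeeping)] -/
theorem gaussRatioC_gaussSymmPart (χ : (ι → ℝ) → ℝ) (M : Matrix ι ι ℂ) (E : (ι → ℝ) → ℂ) : gaussRatioC χ (gaussSymmPart M) E = gaussRatioC χ M E := by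
  unfold gaussRatioC
  rw [gaussIntC_gaussSymmPart, gaussNormC_gaussSymmPart]

variable [DecidableEq ι]

/-- ★★★ **CGRS (iii) THROUGH THE SYMMETRIC PART** — no symmetry hypothesis on `M` at all: if `Re ½(M+Mᵀ) ≻ 0` then
`‖gaussRatioC χ M E‖ ≤ exp(η + ¼·tr(A⁻¹BA⁻¹B))` with `A := Re gaussSymmPart M`, `B := Im gaussSymmPart M`. [cite: Balaban1988RG2Cluster, (1.13)–(1.14) p.5; Brydges1986, §3] -/
theorem norm_gaussRatioC_le_exp_trace_gaussSymmPart (χ : (ι → ℝ) → ℝ) (M : Matrix ι ι ℂ) (E : (ι → ℝ) → ℂ) (η : ℝ)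
    (hA : ((gaussSymmPart M).map Complex.re).PosDef)
    (hχ : ∀ x, 0 ≤ χ x ∧ χ x ≤ 1) (hE : ∀ x, χ x ≠ 0 → (E x).re ≤ η) :
    ‖gaussRatioC χ M E‖
      ≤ Real.exp (η + (1 / 4 : ℝ) * (((gaussSymmPart M).map Complex.re)⁻¹ * (gaussSymmPart M).map Complex.im
          * ((gaussSymmPart M).map Complex.re)⁻¹ * (gaussSymmPart M).map Complex.im).trace) := by
  rw [← gaussRatioC_gaussSymmPart]
  exact norm_gaussRatioC_le_exp_trace χ (gaussSymmPart M) E η hA (isSymm_gaussSymmPart_map_im M) hχ hE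

/-- ★ `gaussNormC M ≠ 0` as soon as `Re ½(M+Mᵀ) ≻ 0` (no symmetry hypothesis). [cite: Balaban1987RG1, (2.12) p.268; Brydges1986, §3] -/
theorem gaussNormC_ne_zero_gaussSymmPart (M : Matrix ι ι ℂ) (hA : ((gaussSymmPart M).map Complex.re).PosDef) : gaussNormC M ≠ 0 := by
  rw [← gaussNormC_gaussSymmPart]
  exact gaussNormC_ne_zero (gaussSymmPart M) hA (isSymm_gaussSymmPart_map_im M)

end Symmetrise

/-! ## §10  THE GAUSSIAN TAIL BRICK for the cut-off face (F-tail): `∫ 𝟙{|x_i| > r}·e^{−½xAx} ≤ 2e^{−r²∕(2(A⁻¹)_ii)}·gaussNormR A` (Chernoff + completing the square + translation invariance) -/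

section Tail

open Matrix

variable [DecidableEq ι]

/-- Integrability of the real Gaussian `e^{−½·quadFormR A}` for `A ≻ 0`. [cite: Brydges1986, §3 (bookkeeping)] -/
theorem integrable_gaussR_of_posDef (A : Matrix ι ι ℝ) (hA : A.PosDef) :
    Integrable (fun x : ι → ℝ => Real.exp (-(1 / 2 : ℝ) * quadFormR A x)) := by
  obtain ⟨P, σ, h1, -⟩ := exists_congruenceFrame A 0 hA (by simp [Matrix.IsSymm])
  exact integrable_gaussR_of_frame A P (det_sq_mul_det_of_frame A P h1).2 h1

/-- `0 < gaussNormR A` for `A ≻ 0`. [cite: Brydges1986, §3 (bookkeeping)] -/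
theorem gaussNormR_pos (A : Matrix ι ι ℝ) (hA : A.PosDef) : 0 < gaussNormR A := by
  have hre : (A.map ((↑) : ℝ → ℂ)).map Complex.re = A := by ext i j; simp
  have him : (A.map ((↑) : ℝ → ℂ)).map Complex.im = 0 := by ext i j; simp
  have h := (gaussNormC_floor (A.map ((↑) : ℝ → ℂ)) (by rw [hre]; exact hA) (by rw [him]; simp [Matrix.IsSymm])).2.1
  rw [hre] at h
  exact h

/-- The i-th column of `A⁻¹` (as a vector): `gaussInvCol A i := A⁻¹ *ᵥ e_i`. [cite: Brydges1986, §3 (bookkeeping)] -/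
def gaussInvCol (A : Matrix ι ι ℝ) (i : ι) : ι → ℝ := A⁻¹ *ᵥ Pi.single i 1

/-- `A *ᵥ gaussInvCol A i = e_i` for `A ≻ 0`. [cite: Brydges1986, §3 (bookkeeping)] -/
theorem mulVec_gaussInvCol (A : Matrix ι ι ℝ) (hA : A.PosDef) (i : ι) : A *ᵥ gaussInvCol A i = Pi.single i 1 := by
  unfold gaussInvCol
  rw [Matrix.mulVec_mulVec, Matrix.mul_nonsing_inv A (hA.det_pos.ne').isUnit, Matrix.one_mulVec]

/-- `(gaussInvCol A i) i = (A⁻¹) i i`. [cite: Brydges1986, §3 (bookkeeping)] -/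
theorem gaussInvCol_apply_self (A : Matrix ι ι ℝ) (i : ι) : gaussInvCol A i i = A⁻¹ i i := by
  simp [gaussInvCol, Matrix.mulVec, dotProduct, Pi.single_apply]

/-- ★ COMPLETING THE SQUARE along the i-th coordinate: `quadFormR A (x − t·gaussInvCol A i) = quadFormR A x − 2t·x_i + t²·(A⁻¹)_ii` (A symmetric positive definite).
[cite: Brydges1986, §3 (bookkeeping)] -/
theorem quadFormR_sub_gaussInvCol (A : Matrix ι ι ℝ) (hA : A.PosDef) (i : ι) (t : ℝ) (x : ι → ℝ) :
    quadFormR A (x - t • gaussInvCol A i) = quadFormR A x - 2 * t * x i + t ^ 2 * A⁻¹ i i := by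
  have hAT : Aᵀ = A := by
    have h := hA.isHermitian
    rw [Matrix.IsHermitian, Matrix.conjTranspose_eq_transpose_of_trivial] at h
    exact h
  have hu : A *ᵥ gaussInvCol A i = Pi.single i 1 := mulVec_gaussInvCol A hA i
  have h1 : x ⬝ᵥ (A *ᵥ (t • gaussInvCol A i)) = t * x i := by
    rw [Matrix.mulVec_smul, hu, dotProduct_smul, dotProduct_single, mul_one, smul_eq_mul]
  have h2 : (t • gaussInvCol A i) ⬝ᵥ (A *ᵥ x) = t * x i := by
    rw [Matrix.dotProduct_mulVec, ← Matrix.mulVec_transpose, hAT, Matrix.mulVec_smul, hu, smul_dotProduct,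
      single_dotProduct, one_mul, smul_eq_mul]
  have h3 : (t • gaussInvCol A i) ⬝ᵥ (A *ᵥ (t • gaussInvCol A i)) = t ^ 2 * A⁻¹ i i := by
    rw [Matrix.mulVec_smul, hu, smul_dotProduct, dotProduct_smul, dotProduct_single, mul_one, gaussInvCol_apply_self,
      smul_eq_mul, smul_eq_mul]
    ring
  rw [quadFormR_eq_dotProduct, quadFormR_eq_dotProduct, Matrix.mulVec_sub, sub_dotProduct, dotProduct_sub,
    dotProduct_sub, h1, h2, h3]
  ring

/-- ★ THE EXPONENTIAL MOMENT (Laplace transform along one coordinate): `∫ e^{t·x_i}·e^{−½xAx} dx = e^{t²(A⁻¹)_ii∕2}·gaussNormR A`, with integrability.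
[cite: Brydges1986, §3 (bookkeeping)] -/
theorem integral_exp_mul_gaussR (A : Matrix ι ι ℝ) (hA : A.PosDef) (i : ι) (t : ℝ) :
    Integrable (fun x : ι → ℝ => Real.exp (t * x i) * Real.exp (-(1 / 2 : ℝ) * quadFormR A x))
    ∧ ∫ x : ι → ℝ, Real.exp (t * x i) * Real.exp (-(1 / 2 : ℝ) * quadFormR A x)
        = Real.exp (t ^ 2 * A⁻¹ i i / 2) * gaussNormR A := by
  set g : (ι → ℝ) → ℝ := fun x => Real.exp (-(1 / 2 : ℝ) * quadFormR A x) with hg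
  have hgi : Integrable g := integrable_gaussR_of_posDef A hA
  have hpt : (fun x : ι → ℝ => Real.exp (t * x i) * Real.exp (-(1 / 2 : ℝ) * quadFormR A x))
      = fun x => Real.exp (t ^ 2 * A⁻¹ i i / 2) * g (x - t • gaussInvCol A i) := by
    funext x
    rw [hg]
    simp only
    rw [← Real.exp_add, ← Real.exp_add, quadFormR_sub_gaussInvCol A hA i t x]
    congr 1
    ring
  rw [hpt]
  refine ⟨((hgi.comp_sub_right (t • gaussInvCol A i)).const_mul _), ?_⟩
  rw [integral_const_mul, integral_sub_right_eq_self g (t • gaussInvCol A i)]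
  rfl

/-- ★★ **THE ONE-COORDINATE GAUSSIAN TAIL** (Chernoff): for `A ≻ 0`, `r ≥ 0` and a coordinate `i`,
`∫ 𝟙{r < |x_i|}·e^{−½xAx} dx ≤ 2·exp(−r²∕(2(A⁻¹)_ii))·gaussNormR A`. [cite: Balaban1987RG1, (2.9) p.266 (small-field characteristic functions); Brydges1986, §3] -/
theorem gaussR_tail_le (A : Matrix ι ι ℝ) (hA : A.PosDef) (i : ι) (r : ℝ) (hr : 0 ≤ r) :
    ∫ x : ι → ℝ, (if r < |x i| then (1 : ℝ) else 0) * Real.exp (-(1 / 2 : ℝ) * quadFormR A x)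
      ≤ 2 * Real.exp (-(r ^ 2 / (2 * A⁻¹ i i))) * gaussNormR A := by
  have hv : 0 < A⁻¹ i i := hA.inv.diag_pos
  set v := A⁻¹ i i with hvdef
  set t := r / v with htdef
  have ht : 0 ≤ t := div_nonneg hr hv.le
  obtain ⟨hint₁, heq₁⟩ := integral_exp_mul_gaussR A hA i t
  obtain ⟨hint₂, heq₂⟩ := integral_exp_mul_gaussR A hA i (-t)
  set g : (ι → ℝ) → ℝ := fun x => Real.exp (-(1 / 2 : ℝ) * quadFormR A x) with hg
  -- the dominating function
  have hdom : ∀ x : ι → ℝ, (if r < |x i| then (1 : ℝ) else 0) * g x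
      ≤ Real.exp (-(t * r)) * (Real.exp (t * x i) * g x) + Real.exp (-(t * r)) * (Real.exp (-t * x i) * g x) := by
    intro x
    have hgx : 0 < g x := Real.exp_pos _
    have hsum : Real.exp (-(t * r)) * (Real.exp (t * x i) * g x) + Real.exp (-(t * r)) * (Real.exp (-t * x i) * g x)
        = (Real.exp (t * (x i - r)) + Real.exp (t * (-x i - r))) * g x := by
      rw [show t * (x i - r) = -(t * r) + t * x i by ring, show t * (-x i - r) = -(t * r) + -t * x i by ring,
        Real.exp_add, Real.exp_add]
      ring
    rw [hsum]
    refine mul_le_mul_of_nonneg_right ?_ hgx.le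
    split_ifs with h
    · rcases lt_abs.mp h with h' | h'
      · have : (1 : ℝ) ≤ Real.exp (t * (x i - r)) := Real.one_le_exp (mul_nonneg ht (by linarith))
        linarith [Real.exp_pos (t * (-x i - r))]
      · have : (1 : ℝ) ≤ Real.exp (t * (-x i - r)) := Real.one_le_exp (mul_nonneg ht (by linarith))
        linarith [Real.exp_pos (t * (x i - r))]
    · positivity
  have hnn : ∀ x : ι → ℝ, 0 ≤ (if r < |x i| then (1 : ℝ) else 0) * g x := fun x =>
    mul_nonneg (by split_ifs <;> norm_num) (by rw [hg]; exact (Real.exp_pos _).le)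
  have hI : Integrable (fun x : ι → ℝ => Real.exp (-(t * r)) * (Real.exp (t * x i) * g x)
      + Real.exp (-(t * r)) * (Real.exp (-t * x i) * g x)) := (hint₁.const_mul _).add (hint₂.const_mul _)
  calc ∫ x : ι → ℝ, (if r < |x i| then (1 : ℝ) else 0) * Real.exp (-(1 / 2 : ℝ) * quadFormR A x)
      ≤ ∫ x : ι → ℝ, (Real.exp (-(t * r)) * (Real.exp (t * x i) * g x) + Real.exp (-(t * r)) * (Real.exp (-t * x i) * g x)) :=
        integral_mono_of_nonneg (Filter.Eventually.of_forall hnn) hI (Filter.Eventually.of_forall hdom)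
    _ = Real.exp (-(t * r)) * (Real.exp (t ^ 2 * v / 2) * gaussNormR A) + Real.exp (-(t * r)) * (Real.exp ((-t) ^ 2 * v / 2) * gaussNormR A) := by
        rw [integral_add (hint₁.const_mul _) (hint₂.const_mul _), integral_const_mul, integral_const_mul, heq₁, heq₂]
    _ = 2 * Real.exp (-(r ^ 2 / (2 * v))) * gaussNormR A := by
        have hv' : v ≠ 0 := hv.ne'
        have hexp : Real.exp (-(t * r)) * Real.exp (t ^ 2 * v / 2) = Real.exp (-(r ^ 2 / (2 * v))) := by
          rw [← Real.exp_add]; congr 1; rw [htdef]; field_simp; ring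
        rw [neg_sq, show 2 * Real.exp (-(r ^ 2 / (2 * v))) * gaussNormR A
            = 2 * (Real.exp (-(t * r)) * Real.exp (t ^ 2 * v / 2)) * gaussNormR A by rw [hexp]]
        ring

/-- ★★ **THE CUT-OFF TAIL FACE (F-tail), GENERIC FORM**: if `0 ≤ χ ≤ 1` and `χ = 1` on the box `{∀ i, |x_i| ≤ r}` (`r ≥ 0`), then for `A ≻ 0`
`∫ (1 − χ)·e^{−½xAx} ≤ (2·Σ_i exp(−r²∕(2(A⁻¹)_ii)))·gaussNormR A` — exactly the hypothesis `htail` of `norm_gaussRatioC_sub_one_le` with `T := 2Σ_i e^{−r²∕(2(A⁻¹)_ii)}`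
(`≤ 2n·e^{−a r²∕2}` when `(A⁻¹)_ii ≤ a⁻¹`). [cite: Balaban1987RG1, (2.9) p.266; Brydges1986, §3] -/
theorem gaussR_cutoff_tail_le (A : Matrix ι ι ℝ) (hA : A.PosDef) (χ : (ι → ℝ) → ℝ) (r : ℝ) (hr : 0 ≤ r)
    (hχ : ∀ x, 0 ≤ χ x ∧ χ x ≤ 1) (hχbox : ∀ x : ι → ℝ, (∀ i, |x i| ≤ r) → χ x = 1) :
    ∫ x : ι → ℝ, (1 - χ x) * Real.exp (-(1 / 2 : ℝ) * quadFormR A x)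
      ≤ (2 * ∑ i, Real.exp (-(r ^ 2 / (2 * A⁻¹ i i)))) * gaussNormR A := by
  set g : (ι → ℝ) → ℝ := fun x => Real.exp (-(1 / 2 : ℝ) * quadFormR A x) with hg
  have hgi : Integrable g := integrable_gaussR_of_posDef A hA
  have hgpos : ∀ x, 0 < g x := fun x => by rw [hg]; exact Real.exp_pos _
  have hmeas : ∀ i, Measurable (fun x : ι → ℝ => if r < |x i| then (1 : ℝ) else 0) := fun i =>
    Measurable.ite (measurableSet_lt measurable_const (continuous_abs.measurable.comp (measurable_pi_apply i)))
      measurable_const measurable_const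
  have hind_int : ∀ i, Integrable (fun x : ι → ℝ => (if r < |x i| then (1 : ℝ) else 0) * g x) := by
    intro i
    refine hgi.mono' ((hmeas i).aestronglyMeasurable.mul hgi.aestronglyMeasurable) (Filter.Eventually.of_forall fun x => ?_)
    rw [Real.norm_eq_abs, abs_mul, abs_of_pos (hgpos x)]
    refine mul_le_of_le_one_left (hgpos x).le ?_
    split_ifs <;> simp
  have hdom : ∀ x : ι → ℝ, (1 - χ x) * g x ≤ (∑ i, if r < |x i| then (1 : ℝ) else 0) * g x := by
    intro x
    refine mul_le_mul_of_nonneg_right ?_ (hgpos x).le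
    by_cases hbox : ∀ i, |x i| ≤ r
    · rw [hχbox x hbox, sub_self]
      exact Finset.sum_nonneg fun i _ => by split_ifs <;> norm_num
    · obtain ⟨i, hi⟩ := not_forall.mp hbox
      have hi' : r < |x i| := not_le.mp hi
      calc 1 - χ x ≤ 1 := by linarith [(hχ x).1]
        _ = (if r < |x i| then (1 : ℝ) else 0) := by rw [if_pos hi']
        _ ≤ ∑ j, (if r < |x j| then (1 : ℝ) else 0) :=
          Finset.single_le_sum (f := fun j => if r < |x j| then (1 : ℝ) else 0) (fun j _ => by
            show (0 : ℝ) ≤ (if r < |x j| then (1 : ℝ) else 0)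
            split_ifs <;> norm_num) (Finset.mem_univ i)
  have hnn : ∀ x : ι → ℝ, 0 ≤ (1 - χ x) * g x := fun x => mul_nonneg (by linarith [(hχ x).2]) (hgpos x).le
  have hsum : (fun x : ι → ℝ => (∑ i, if r < |x i| then (1 : ℝ) else 0) * g x)
      = fun x => ∑ i, (if r < |x i| then (1 : ℝ) else 0) * g x := by
    funext x; rw [Finset.sum_mul]
  have hI : Integrable (fun x : ι → ℝ => (∑ i, if r < |x i| then (1 : ℝ) else 0) * g x) := by
    rw [hsum]; exact integrable_finsetSum _ fun i _ => hind_int i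
  calc ∫ x : ι → ℝ, (1 - χ x) * Real.exp (-(1 / 2 : ℝ) * quadFormR A x)
      ≤ ∫ x : ι → ℝ, (∑ i, if r < |x i| then (1 : ℝ) else 0) * g x :=
        integral_mono_of_nonneg (Filter.Eventually.of_forall hnn) hI (Filter.Eventually.of_forall hdom)
    _ = ∑ i, ∫ x : ι → ℝ, (if r < |x i| then (1 : ℝ) else 0) * g x := by
        rw [hsum, integral_finsetSum _ fun i _ => hind_int i]
    _ ≤ ∑ i, 2 * Real.exp (-(r ^ 2 / (2 * A⁻¹ i i))) * gaussNormR A :=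
        Finset.sum_le_sum fun i _ => gaussR_tail_le A hA i r hr
    _ = (2 * ∑ i, Real.exp (-(r ^ 2 / (2 * A⁻¹ i i)))) * gaussNormR A := by
        rw [Finset.mul_sum, Finset.sum_mul]

/-- The complex Gaussian integrand `x ↦ exp(−½·quadC M x)` is integrable as soon as `Re M ≻ 0` (its modulus is the real Gaussian of `Re M`). [cite: Brydges1986, §3 (bookkeeping)] -/
theorem integrable_gaussNormC_integrand (M : Matrix ι ι ℂ) (hA : (M.map Complex.re).PosDef) :
    Integrable (fun x : ι → ℝ => Complex.exp (-(1 / 2 : ℂ) * quadC M x)) := by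
  refine (integrable_gaussR_of_posDef (M.map Complex.re) hA).mono' ?_ (Filter.Eventually.of_forall fun x => (norm_gaussNormIntegrand M x).le)
  exact (Continuous.cexp (continuous_const.mul (continuous_quadC_real M))).aestronglyMeasurable

/-- ★★★ **CGRS (iv) WITH THE TAIL DISCHARGED — the `|c| = 1` clause of N4-R in closed form**: for `Re M ≻ 0`, `Im M` symmetric, a cut-off `0 ≤ χ ≤ 1` equal to `1` on the box
`{∀ i, |x_i| ≤ r}`, and `‖exp(E x) − 1‖ ≤ η₁` on `{χ ≠ 0}`:
`‖gaussRatioC χ M E − 1‖ ≤ exp(¼·tr(A⁻¹BA⁻¹B))·(η₁ + 2Σ_i exp(−r²∕(2(A⁻¹)_ii)))` (A = Re M, B = Im M).  Remaining displayed hypotheses: integrability (= measurability) of the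
numerator and of `(1−χ)·Gaussian` — model bookkeeping (χ an indicator of a box, `E` continuous). [cite: Balaban1988RG2Cluster, (1.7)–(1.10) p.4; Balaban1987RG1, (2.9) p.266; Brydges1986, §3] -/
theorem norm_gaussRatioC_sub_one_le_box (χ : (ι → ℝ) → ℝ) (M : Matrix ι ι ℂ) (E : (ι → ℝ) → ℂ) (η₁ r : ℝ)
    (hA : (M.map Complex.re).PosDef) (hB : (M.map Complex.im).IsSymm) (hr : 0 ≤ r)
    (hχ : ∀ x, 0 ≤ χ x ∧ χ x ≤ 1) (hχbox : ∀ x : ι → ℝ, (∀ i, |x i| ≤ r) → χ x = 1)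
    (hη₁ : 0 ≤ η₁) (hE : ∀ x, χ x ≠ 0 → ‖Complex.exp (E x) - 1‖ ≤ η₁)
    (hnum : Integrable (fun x : ι → ℝ => (χ x : ℂ) * Complex.exp (-(1 / 2 : ℂ) * quadC M x + E x)))
    (htail_int : Integrable (fun x : ι → ℝ => (1 - χ x) * Real.exp (-(1 / 2 : ℝ) * quadFormR (M.map Complex.re) x))) :
    ‖gaussRatioC χ M E - 1‖
      ≤ Real.exp ((1 / 4 : ℝ) * ((M.map Complex.re)⁻¹ * M.map Complex.im * (M.map Complex.re)⁻¹ * M.map Complex.im).trace)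
        * (η₁ + 2 * ∑ i, Real.exp (-(r ^ 2 / (2 * (M.map Complex.re)⁻¹ i i)))) :=
  norm_gaussRatioC_sub_one_le_trace χ M E η₁ _ hA hB hχ hη₁ hE hnum (integrable_gaussNormC_integrand M hA) htail_int
    (gaussR_cutoff_tail_le (M.map Complex.re) hA χ r hr hχ hχbox)

end Tail

end Summit.QuantumFields.YangMills.Theorems.K0AxComplexGaussianRatio

end
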